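import Literature.MathematicalPhysics.QuantumFieldTheory.UnitaryChartTransition
import HarnessLib

/-!
# The volume of `U(N)`: Chatterjee's small-ball constant `∏_{j<N} j!/(2π)^{N(N+1)/2}`

Final step of the proof, by induction on `N` and WITHOUT Weyl's integration formula, of

  `haarChartConst N = ∏_{j=1}^{N-1} j! / (2π)^{N(N+1)/2}`       (`haarChartConst_eq`),

the density at `1` of the Haar probability measure of `U(N)` with respect to Lebesgue measure in
Hilbert–Schmidt-isometric coordinates (the soft constant `c_N` of `UnitaryCayleyChart`, defined
there as `lim_{δ→0} σ(B_HS(1,δ))/vol(b(0,δ))`), equivalently `vol_HS(U(N)) = (2π)^{N(N+1)/2}/∏ j!`,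
equivalently S. Chatterjee, *The leading term of the Yang–Mills free energy*, J. Funct. Anal. 271
(2016), arXiv:1602.01222, **Theorem 6.1** in its printed form (`tendsto_haar_gball_div`):

  `lim_{δ→0} σ{U : ‖I - U‖_HS ≤ δ}/δ^{N²} = ∏_{j=1}^{N-1} j! / ((2π)^{N/2} 2^{N²/2} Γ(N²/2+1))`,

and the constant `C_N = ∏_{j<N} j!/(2π)^{N(N+1)/2}` of his Theorem 11.1. This is the one ingredient
by which the printed main theorem (Thm. 2.1, the named fact `chatterjee_freeEnergy` of `Sweep1`)
differs from its soft version `chatterjee_freeEnergyDensity`. Everything here is proved; no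
definition of `Prop` type (named fact) is introduced.

## The argument (`haarChartConst_succ`: `c_{N+1} = c_N · N!/(2π)^{N+1}`; `haarChartConst_zero`: `c_0 = 1`)

Let `S_δ ⊆ ℝ^{(N+1)²}` be the coordinate box `{|t| ≤ δ, |w| < δ, ‖a'‖ ≤ δ}` (`Sbox`). On the one
hand `S_δ` is, after regrouping coordinates (`Ξf`, a volume-preserving equivalence, `σE`), a
product of three Euclidean balls, so `vol(S_δ) = vol(B̄_{ℝ^{N²}}(δ)) · 2δ · (δ√2)^{2N} π^N/N!`
(`volume_Sbox`; the `√2` because `|w_j|² = (a_{j+1,0}² + a_{0,j+1}²)/2`). On the other hand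
`chart(Φ(S_δ))` is the coordinate box `{R(w) diag(W, e^{it}) : |t| ≤ δ, |w| < δ, W ∈ chart(B̄(δ))}`
of `U(N+1)` (`image_chart_Phi_Sbox`), whose Haar probability is `(δ/π) δ^{2N} ν_N(B̄(δ))` by
`UnitaryColumnLaw.haar_image_mk_box` (`chartMeasure_image_Phi_Sbox`). Since `Φ` approximates the
identity (`UnitaryChartTransition.approximatesLinearOn_Phi`), `vol(Φ(S_δ))/vol(S_δ) → 1`, and the
two-sided density bounds of `UnitaryCayleyChart` (`chartMeasure_le`, `le_chartMeasure_of_subset`)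
for `N` and `N+1` squeeze the ratio (`sandwich`): letting `δ → 0` and then the distortion `→ 1`
gives `c_{N+1} · 2^{N+1} π^N/N! = c_N/π` (`haarChartConst_succ_mul_QN`).

## References

* S. Chatterjee, *The leading term of the Yang–Mills free energy*, J. Funct. Anal. 271 (2016)
  2944–3005, arXiv:1602.01222, §6 (Thm. 6.1, Cor. 6.3), §11 (Thm. 11.1). [arXiv160201222]
* Standard (volume of `U(N)`): J. Faraut, *Analysis on Lie groups*, CUP 2008, §9; I. G. Macdonald,
  *The volume of a compact Lie group*, Invent. Math. 56 (1980) 93–95.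
-/

noncomputable section

open scoped Matrix.Norms.Frobenius
open MeasureTheory Measure Set Filter Topology Complex Matrix
open scoped ENNReal NNReal Real

namespace Literature.MathematicalPhysics.QuantumFieldTheory

namespace UnitaryColumn

open UnitaryCayley
open Literature.Probability.RandomMatrix (nsq nsq_nonneg nsq_eq_zero_iff)

variable {N : ℕ}

/-! ### The coordinate box and its Lebesgue volume -/

section Box

open WithLp

/-- The index type `(Fin N × Fin N) ⊕ (Fin 1 ⊕ (Fin N ⊕ Fin N))` regrouping the coordinates of
`ℝ^{(N+1)²}` into fibre block, phase, and sphere block. [folklore] -/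
abbrev J (N : ℕ) : Type := (Fin N × Fin N) ⊕ (Fin 1 ⊕ (Fin N ⊕ Fin N))

/-- The regrouping map `J N → Fin (N+1) × Fin (N+1)`. [folklore] -/
def σfun : J N → Fin (N + 1) × Fin (N + 1)
  | Sum.inl p => (p.1.succ, p.2.succ)
  | Sum.inr (Sum.inl _) => (0, 0)
  | Sum.inr (Sum.inr (Sum.inl j)) => (j.succ, 0)
  | Sum.inr (Sum.inr (Sum.inr j)) => (0, j.succ)

/-- The inverse regrouping map. [folklore] -/
def σinv (q : Fin (N + 1) × Fin (N + 1)) : J N :=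
  Fin.cases (Fin.cases (Sum.inr (Sum.inl 0)) (fun k => Sum.inr (Sum.inr (Sum.inr k))) q.2)
    (fun j => Fin.cases (Sum.inr (Sum.inr (Sum.inl j))) (fun k => Sum.inl (j, k)) q.2) q.1

/-- The regrouping equivalence `J N ≃ Fin (N+1) × Fin (N+1)`. [folklore] -/
def σE (N : ℕ) : J N ≃ Fin (N + 1) × Fin (N + 1) where
  toFun := σfun
  invFun := σinv
  left_inv x := by
    rcases x with ⟨j, k⟩ | x
    · simp [σfun, σinv]
    · rcases x with u | x
      · obtain rfl : u = 0 := Subsingleton.elim _ _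
        simp [σfun, σinv]
      · rcases x with j | j <;> simp [σfun, σinv]
  right_inv q := by
    obtain ⟨i, k⟩ := q
    refine Fin.cases ?_ (fun j => ?_) i
    · refine Fin.cases ?_ (fun l => ?_) k <;> simp [σfun, σinv]
    · refine Fin.cases ?_ (fun l => ?_) k <;> simp [σfun, σinv]

/-- The coordinate regrouping `Ξ(a) = (a', (a₀₀), (a_{j+1,0}, a_{0,j+1})_j)`. [folklore] -/
def Ξf (a : 𝔼 (N + 1)) : (Fin N × Fin N → ℝ) × ((Fin 1 → ℝ) × (Fin N ⊕ Fin N → ℝ)) :=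
  (fun p => a (p.1.succ, p.2.succ), (fun _ => a (0, 0), Sum.elim (fun j => a (j.succ, 0)) (fun j => a (0, j.succ))))

/-- `Ξ` as a composite of standard measurable equivalences. [folklore] -/
theorem Ξf_eq :
    (Ξf : 𝔼 (N + 1) → _) =
      (Prod.map id (MeasurableEquiv.sumPiEquivProdPi fun _ : Fin 1 ⊕ (Fin N ⊕ Fin N) => ℝ)) ∘
        (MeasurableEquiv.sumPiEquivProdPi fun _ : J N => ℝ) ∘
          (MeasurableEquiv.piCongrLeft (fun _ : Fin (N + 1) × Fin (N + 1) => ℝ) (σE N)).symm ∘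
            (ofLp : 𝔼 (N + 1) → Fin (N + 1) × Fin (N + 1) → ℝ) := by
  funext a
  simp only [Function.comp_apply, Ξf]
  refine Prod.ext ?_ (Prod.ext ?_ ?_)
  · funext p
    rfl
  · funext u
    obtain rfl : u = 0 := Subsingleton.elim _ _
    rfl
  · funext s
    rcases s with j | j <;> rfl

/-- **`Ξ` preserves Lebesgue measure.** [folklore] -/
theorem measurePreserving_Ξf : MeasurePreserving (Ξf : 𝔼 (N + 1) → _) volume volume := by
  rw [Ξf_eq]
  refine ((MeasurePreserving.id _).prod (volume_measurePreserving_sumPiEquivProdPi _)).comp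
    ((volume_measurePreserving_sumPiEquivProdPi _).comp
      (((volume_measurePreserving_piCongrLeft _ (σE N)).symm _).comp (PiLp.volume_preserving_ofLp _)))

/-- The coordinate box `S_δ = {|t| ≤ δ, |w| < δ, ‖a'‖ ≤ δ}`. [folklore] -/
def Sbox (N : ℕ) (δ : ℝ) : Set (𝔼 (N + 1)) := {a | |tOf a| ≤ δ ∧ nsq (wv a) < δ ^ 2 ∧ ‖minor a‖ ≤ δ}

/-- `2 |w(a)|² = Σ_j (a_{j+1,0}² + a_{0,j+1}²)`. [folklore] -/
theorem two_mul_nsq_wv (a : 𝔼 (N + 1)) : 2 * nsq (wv a) = ∑ j : Fin N, (a (j.succ, 0) ^ 2 + a (0, j.succ) ^ 2) := by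
  rw [nsq, Finset.mul_sum]
  refine Finset.sum_congr rfl fun j _ => ?_
  rw [wv, skewOf_apply, Complex.sq_norm, Complex.normSq_mk]
  ring

/-- The fibre factor: `{x | toLp x ∈ B̄(0, δ)}`. [folklore] -/
def A₁ (N : ℕ) (δ : ℝ) : Set (Fin N × Fin N → ℝ) := (toLp 2) ⁻¹' Metric.closedBall (0 : 𝔼 N) δ

/-- The phase factor: `{|y₀| ≤ δ}`. [folklore] -/
def A₂ (δ : ℝ) : Set (Fin 1 → ℝ) := {y | |y 0| ≤ δ}

/-- The sphere factor: `{z | toLp z ∈ B(0, δ√2)}`. [folklore] -/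
def A₃ (N : ℕ) (δ : ℝ) : Set (Fin N ⊕ Fin N → ℝ) :=
  (toLp 2) ⁻¹' Metric.ball (0 : EuclideanSpace ℝ (Fin N ⊕ Fin N)) (δ * Real.sqrt 2)

/-- **The box is a product in the regrouped coordinates.** [folklore] -/
theorem Sbox_eq_preimage {δ : ℝ} (hδ : 0 ≤ δ) : Sbox N δ = Ξf ⁻¹' (A₁ N δ ×ˢ (A₂ δ ×ˢ A₃ N δ)) := by
  ext a
  simp only [Sbox, mem_setOf_eq, mem_preimage, mem_prod, A₁, A₂, A₃, Metric.mem_closedBall, Metric.mem_ball,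
    dist_zero_right]
  have h1 : ‖minor a‖ = ‖toLp 2 (Ξf a).1‖ := rfl
  have h2 : tOf a = (Ξf a).2.1 0 := rfl
  have h3 : ‖toLp 2 (Ξf a).2.2‖ ^ 2 = 2 * nsq (wv a) := by
    rw [EuclideanSpace.norm_eq, Real.sq_sqrt (Finset.sum_nonneg fun _ _ => by positivity), two_mul_nsq_wv,
      Fintype.sum_sum_type, ← Finset.sum_add_distrib]
    refine Finset.sum_congr rfl fun j _ => ?_
    simp [Ξf, Real.norm_eq_abs, sq_abs]
  have h4 : nsq (wv a) < δ ^ 2 ↔ ‖toLp 2 (Ξf a).2.2‖ < δ * Real.sqrt 2 := by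
    have hs : 0 ≤ ‖toLp 2 (Ξf a).2.2‖ := norm_nonneg _
    have h2s : (δ * Real.sqrt 2) ^ 2 = 2 * δ ^ 2 := by
      rw [mul_pow, Real.sq_sqrt (by norm_num)]; ring
    constructor
    · intro h
      have : ‖toLp 2 (Ξf a).2.2‖ ^ 2 < (δ * Real.sqrt 2) ^ 2 := by rw [h3, h2s]; linarith
      exact lt_of_pow_lt_pow_left₀ 2 (by positivity) this
    · intro h
      have : ‖toLp 2 (Ξf a).2.2‖ ^ 2 < (δ * Real.sqrt 2) ^ 2 := pow_lt_pow_left₀ h hs two_ne_zero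
      rw [h3, h2s] at this; linarith
  rw [h1, h2, h4]
  tauto

/-- The fibre factor has the volume of the `δ`-ball of `ℝ^{N²}`. [folklore] -/
theorem volume_A₁ (δ : ℝ) : volume (A₁ N δ) = volume (Metric.closedBall (0 : 𝔼 N) δ) :=
  (PiLp.volume_preserving_toLp (Fin N × Fin N)).measure_preimage Metric.isClosed_closedBall.measurableSet.nullMeasurableSet

/-- The phase factor has volume `2δ`. [folklore] -/
theorem volume_A₂ (δ : ℝ) : volume (A₂ δ) = ENNReal.ofReal (2 * δ) := by
  have h := (volume_preserving_funUnique (Fin 1) ℝ).measure_preimage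
    (measurableSet_Icc (a := -δ) (b := δ)).nullMeasurableSet
  have hset : A₂ δ = (MeasurableEquiv.funUnique (Fin 1) ℝ) ⁻¹' Icc (-δ) δ := by
    ext y; simp [A₂, abs_le, MeasurableEquiv.funUnique]
  rw [hset]
  refine h.trans ?_
  rw [Real.volume_Icc]
  congr 1; ring

/-- The sphere factor has the volume of the `δ√2`-ball of `ℝ^{2N}`. [folklore] -/
theorem volume_A₃ (δ : ℝ) :
    volume (A₃ N δ) = volume (Metric.ball (0 : EuclideanSpace ℝ (Fin N ⊕ Fin N)) (δ * Real.sqrt 2)) :=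
  (PiLp.volume_preserving_toLp (Fin N ⊕ Fin N)).measure_preimage Metric.isOpen_ball.measurableSet.nullMeasurableSet

/-- **Volume of the `δ√2`-ball of `ℝ^{2N}`**: `(δ√2)^{2N} π^N/N!` for `δ > 0` (also for `N = 0`). [folklore] -/
theorem volume_ball_sum {δ : ℝ} (hδ : 0 < δ) :
    volume (Metric.ball (0 : EuclideanSpace ℝ (Fin N ⊕ Fin N)) (δ * Real.sqrt 2)) =
      ENNReal.ofReal (δ ^ (2 * N)) * ENNReal.ofReal (2 ^ N * π ^ N / N.factorial) := by
  rcases Nat.eq_zero_or_pos N with hN | hN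
  · subst hN
    have huniv : Metric.ball (0 : EuclideanSpace ℝ (Fin 0 ⊕ Fin 0)) (δ * Real.sqrt 2) = univ := by
      ext x
      simp only [Metric.mem_ball, dist_zero_right, mem_univ, iff_true]
      have : x = 0 := Subsingleton.elim _ _
      rw [this, norm_zero]; positivity
    rw [huniv, volume_euclideanSpace_eq_dirac]; simp
  · haveI : Nonempty (Fin N ⊕ Fin N) := ⟨Sum.inl ⟨0, hN⟩⟩
    rw [EuclideanSpace.volume_ball, Fintype.card_sum, Fintype.card_fin, ← two_mul,
      ← ENNReal.ofReal_pow (by positivity), ← ENNReal.ofReal_mul (by positivity),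
      ← ENNReal.ofReal_mul (by positivity)]
    congr 1
    have h1 : Real.sqrt 2 ^ (2 * N) = 2 ^ N := by rw [pow_mul, Real.sq_sqrt (by norm_num)]
    have h2 : Real.sqrt π ^ (2 * N) = π ^ N := by rw [pow_mul, Real.sq_sqrt Real.pi_pos.le]
    have h3 : Real.Gamma ((2 * N : ℕ) / 2 + 1) = N.factorial := by
      rw [show ((2 * N : ℕ) / 2 + 1 : ℝ) = N + 1 by push_cast; ring, Real.Gamma_nat_eq_factorial]
    rw [mul_pow, h1, h2, h3]; ring

/-- **Volume of the coordinate box**: `vol(S_δ) = vol(B̄_{ℝ^{N²}}(0,δ)) · 2δ · (δ√2)^{2N} π^N/N!`. [folklore] -/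
theorem volume_Sbox {δ : ℝ} (hδ : 0 < δ) :
    volume (Sbox N δ) = volume (Metric.closedBall (0 : 𝔼 N) δ) *
      (ENNReal.ofReal (2 * δ) * (ENNReal.ofReal (δ ^ (2 * N)) * ENNReal.ofReal (2 ^ N * π ^ N / N.factorial))) := by
  have hm1 : MeasurableSet (A₁ N δ) := (PiLp.continuous_toLp 2 _).measurable Metric.isClosed_closedBall.measurableSet
  have hm2 : MeasurableSet (A₂ δ) := by
    have : A₂ δ = (fun y : Fin 1 → ℝ => |y 0|) ⁻¹' Iic δ := rfl
    rw [this]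
    exact (continuous_abs.comp (continuous_apply 0)).measurable measurableSet_Iic
  have hm3 : MeasurableSet (A₃ N δ) := (PiLp.continuous_toLp 2 _).measurable Metric.isOpen_ball.measurableSet
  rw [Sbox_eq_preimage hδ.le, measurePreserving_Ξf.measure_preimage ((hm1.prod (hm2.prod hm3))).nullMeasurableSet,
    show (volume : Measure ((Fin N × Fin N → ℝ) × ((Fin 1 → ℝ) × (Fin N ⊕ Fin N → ℝ)))) =
      volume.prod (volume.prod volume) from rfl,
    Measure.prod_prod, Measure.prod_prod, volume_A₁, volume_A₂, volume_A₃, volume_ball_sum hδ]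

/-- The box lies in the ball of radius `2δ`. [folklore] -/
theorem norm_le_of_mem_Sbox {δ : ℝ} (hδ : 0 ≤ δ) {a : 𝔼 (N + 1)} (ha : a ∈ Sbox N δ) : ‖a‖ ≤ 2 * δ := by
  obtain ⟨h1, h2, h3⟩ := ha
  have hdecomp : ‖a‖ ^ 2 = tOf a ^ 2 + 2 * nsq (wv a) + ‖minor a‖ ^ 2 := by
    rw [EuclideanSpace.norm_eq, Real.sq_sqrt (Finset.sum_nonneg fun _ _ => by positivity),
      EuclideanSpace.norm_eq, Real.sq_sqrt (Finset.sum_nonneg fun _ _ => by positivity), two_mul_nsq_wv,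
      ← Equiv.sum_comp (σE N) (fun q => ‖a q‖ ^ 2), Fintype.sum_sum_type, Fintype.sum_sum_type,
      Fintype.sum_sum_type, Fin.sum_univ_one]
    simp only [σE, Equiv.coe_fn_mk, σfun, Real.norm_eq_abs, sq_abs, minor_apply, tOf, Fintype.sum_prod_type,
      Finset.sum_add_distrib]
    ring
  have h4 : ‖a‖ ^ 2 ≤ (2 * δ) ^ 2 := by
    rw [hdecomp]
    have := sq_abs (tOf a); have := abs_nonneg (tOf a)
    nlinarith [norm_nonneg (minor a)]
  exact le_of_pow_le_pow_left₀ two_ne_zero (by positivity) h4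

end Box

/-! ### The image of the box in the Cayley chart -/

section Image

open WithLp

/-- The inverse of the coordinate map `a ↦ (t(a), w(a), a')`. [folklore] -/
def assemble (t : ℝ) (w : Fin N → ℂ) (m : 𝔼 N) : 𝔼 (N + 1) :=
  toLp 2 fun q : Fin (N + 1) × Fin (N + 1) =>
    match (σE N).symm q with
    | Sum.inl p => m p
    | Sum.inr (Sum.inl _) => t
    | Sum.inr (Sum.inr (Sum.inl j)) => (w j).re + (w j).im
    | Sum.inr (Sum.inr (Sum.inr j)) => (w j).im - (w j).re

/-- Values of `assemble` at the regrouped coordinates. [folklore] -/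
theorem assemble_apply_σE (t : ℝ) (w : Fin N → ℂ) (m : 𝔼 N) (x : J N) :
    assemble t w m (σE N x) =
      match x with
      | Sum.inl p => m p
      | Sum.inr (Sum.inl _) => t
      | Sum.inr (Sum.inr (Sum.inl j)) => (w j).re + (w j).im
      | Sum.inr (Sum.inr (Sum.inr j)) => (w j).im - (w j).re := by
  simp only [assemble, PiLp.toLp_apply, Equiv.symm_apply_apply]

/-- `t(assemble(t, w, m)) = t`. [folklore] -/
theorem tOf_assemble (t : ℝ) (w : Fin N → ℂ) (m : 𝔼 N) : tOf (assemble t w m) = t := by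
  have h := assemble_apply_σE t w m (Sum.inr (Sum.inl 0))
  exact h

/-- `w(assemble(t, w, m)) = w`. [folklore] -/
theorem wv_assemble (t : ℝ) (w : Fin N → ℂ) (m : 𝔼 N) : wv (assemble t w m) = w := by
  funext j
  have h1 : assemble t w m (j.succ, 0) = (w j).re + (w j).im := assemble_apply_σE t w m (Sum.inr (Sum.inr (Sum.inl j)))
  have h2 : assemble t w m (0, j.succ) = (w j).im - (w j).re := assemble_apply_σE t w m (Sum.inr (Sum.inr (Sum.inr j)))
  rw [wv, skewOf_apply, h1, h2]
  apply Complex.ext <;> simp <;> ring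

/-- `(assemble(t, w, m))' = m`. [folklore] -/
theorem minor_assemble (t : ℝ) (w : Fin N → ℂ) (m : 𝔼 N) : minor (assemble t w m) = m := by
  ext ⟨j, k⟩
  rw [minor_apply]
  exact assemble_apply_σE t w m (Sum.inl (j, k))

/-- **The chart image of `Φ(S_δ)` is the coordinate box of `U(N+1)`** (for `2δ ≤ r_N`). [folklore] -/
theorem image_chart_Phi_Sbox {δ : ℝ} (hδ : 0 ≤ δ) (hδr : 2 * δ ≤ rN N) :
    chart '' (Phi '' Sbox N δ) =
      (fun p : ℝ × (Fin N → ℂ) × 𝔾 N => mk p.1 p.2.1 p.2.2) ''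
        (Icc (-δ) δ ×ˢ (cball N δ ×ˢ (chart '' Metric.closedBall (0 : 𝔼 N) δ))) := by
  ext U
  simp only [mem_image, mem_prod, mem_Icc, Prod.exists]
  constructor
  · rintro ⟨x, ⟨a, ha, rfl⟩, rfl⟩
    have har : ‖a‖ ≤ rN N := (norm_le_of_mem_Sbox hδ ha).trans hδr
    obtain ⟨h1, h2, h3⟩ := ha
    refine ⟨tOf a, wv a, chart (minor a), ⟨abs_le.1 h1, h2, minor a, ?_, rfl⟩, (chart_Phi har).symm⟩
    rwa [Metric.mem_closedBall, dist_zero_right]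
  · rintro ⟨t, w, W, ⟨ht, hw, m, hm, rfl⟩, rfl⟩
    rw [Metric.mem_closedBall, dist_zero_right] at hm
    have hmem : assemble t w m ∈ Sbox N δ := by
      refine ⟨?_, ?_, ?_⟩
      · rw [tOf_assemble]; exact abs_le.2 ht
      · rw [wv_assemble]; exact hw
      · rw [minor_assemble]; exact hm
    have har : ‖assemble t w m‖ ≤ rN N := (norm_le_of_mem_Sbox hδ hmem).trans hδr
    refine ⟨Phi (assemble t w m), ⟨assemble t w m, hmem, rfl⟩, ?_⟩
    rw [chart_Phi har, tOf_assemble, wv_assemble, minor_assemble]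

/-- **Haar measure of `Φ(S_δ)` in the chart**:
`ν_{N+1}(Φ(S_δ)) = (δ/π) δ^{2N} ν_N(B̄(0,δ))` for `0 < δ ≤ 1`, `2δ ≤ r_N`. [folklore] -/
theorem chartMeasure_image_Phi_Sbox {δ : ℝ} (hδ : 0 < δ) (hδ1 : δ ≤ 1) (hδr : 2 * δ ≤ rN N) :
    chartMeasure (N + 1) (Phi '' Sbox N δ) =
      ENNReal.ofReal (δ / π) * ENNReal.ofReal (δ ^ (2 * N)) * chartMeasure N (Metric.closedBall 0 δ) := by
  have hδπ : δ ≤ π := hδ1.trans (by linarith [Real.pi_gt_three])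
  rw [chartMeasure_apply, image_chart_Phi_Sbox hδ.le hδr,
    haar_image_mk_box hδπ hδ hδ1 (measurableSet_image_chart Metric.isClosed_closedBall.measurableSet),
    ← chartMeasure_apply]

end Image

/-! ### The induction step: `c_{N+1} · 2^{N+1} π^N / N! = c_N / π` -/

section Limit

open Metric

/-- `lowerConst n (k δ) → c_n` as `δ → 0⁺` (`κ` is continuous with `κ(0) = 1`). [folklore] -/
theorem tendsto_lowerConst (n : ℕ) (k : ℝ) :
    Tendsto (fun δ : ℝ => lowerConst n (k * δ)) (𝓝[>] 0) (𝓝 (haarChartConst n : ℝ≥0∞)) := by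
  have h1 : Tendsto (fun δ : ℝ => ENNReal.ofReal (κ (k * δ) ^ (n * n))) (𝓝[>] 0) (𝓝 (ENNReal.ofReal 1)) := by
    refine ENNReal.tendsto_ofReal ?_
    have hc : Continuous fun δ : ℝ => κ (k * δ) ^ (n * n) := (continuous_κ.comp (continuous_const.mul continuous_id)).pow _
    have := hc.continuousAt.tendsto (x := 0)
    simp only [mul_zero, κ_zero, one_pow] at this
    exact this.mono_left nhdsWithin_le_nhds
  rw [ENNReal.ofReal_one] at h1
  have h2 : Tendsto (fun δ : ℝ => (ENNReal.ofReal (κ (k * δ) ^ (n * n)))⁻¹) (𝓝[>] 0) (𝓝 1) := by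
    have := tendsto_inv_iff.2 h1
    simpa using this
  have h3 := ENNReal.Tendsto.mul_const h2 (b := (haarChartConst n : ℝ≥0∞)) (Or.inl one_ne_zero)
  simp only [one_mul] at h3
  exact h3

/-- The volume of Euclidean balls of `ℝ^{N²}` is positive and finite. [folklore] -/
theorem volume_closedBall_ne {n : ℕ} {δ : ℝ} (hδ : 0 < δ) :
    volume (closedBall (0 : 𝔼 n) δ) ≠ 0 ∧ volume (closedBall (0 : 𝔼 n) δ) ≠ ∞ :=
  ⟨(volume_closedBall_𝔼_pos (0 : 𝔼 n) hδ).ne', (volume_closedBall_𝔼_lt_top (0 : 𝔼 n) δ).ne⟩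

/-- The constant `Q_N = 2^{N+1} π^N / N!` (as a real number). [folklore] -/
def QN (N : ℕ) : ℝ := 2 ^ (N + 1) * π ^ N / N.factorial

/-- `0 < Q_N`. [folklore] -/
theorem QN_pos (N : ℕ) : 0 < QN N := by unfold QN; positivity

/-- **The two-sided estimate behind the induction step.** For every `m₋ < 1 < m₊` there is `δ₀ > 0`
such that for all `0 < δ ≤ δ₀`:
`lowerConst_N(δ)/π ≤ c_{N+1} m₊ Q_N` and `lowerConst_{N+1}(4δ) m₋ Q_N ≤ c_N/π`. [folklore] -/
theorem sandwich {mlo mhi : ℝ≥0} (hlo : mlo < 1) (hhi : 1 < mhi) :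
    ∃ δ₀ : ℝ, 0 < δ₀ ∧ ∀ δ : ℝ, 0 < δ → δ ≤ δ₀ →
      lowerConst N δ * ENNReal.ofReal (1 / π) ≤ (haarChartConst (N + 1) : ℝ≥0∞) * mhi * ENNReal.ofReal (QN N) ∧
      lowerConst (N + 1) (4 * δ) * mlo * ENNReal.ofReal (QN N) ≤ (haarChartConst N : ℝ≥0∞) * ENNReal.ofReal (1 / π) := by
  -- the volume distortion of `Φ`
  have hdet : ENNReal.ofReal |(ContinuousLinearMap.id ℝ (𝔼 (N + 1))).det| = 1 := by
    simp [ContinuousLinearMap.det]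
  have hup := addHaar_image_le_mul_of_det_lt (volume : Measure (𝔼 (N + 1))) (ContinuousLinearMap.id ℝ (𝔼 (N + 1)))
    (m := mhi) (by rw [hdet]; exact_mod_cast hhi)
  have hlow := mul_le_addHaar_image_of_lt_det (volume : Measure (𝔼 (N + 1))) (ContinuousLinearMap.id ℝ (𝔼 (N + 1)))
    (m := mlo) (by rw [hdet]; exact_mod_cast hlo)
  have hlt1 : ∀ᶠ c : ℝ≥0 in 𝓝[>] 0, c < 1 := nhdsWithin_le_nhds (Iio_mem_nhds zero_lt_one)
  obtain ⟨c, ⟨⟨hcup, hclow⟩, hc1⟩, hc0⟩ := (((hup.and hlow).and hlt1).and self_mem_nhdsWithin).exists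
  have hc0' : 0 < c := hc0
  obtain ⟨r, hr0, hrN, happ⟩ := approximatesLinearOn_Phi (N := N) hc0'
  refine ⟨min (r / 2) (1 / 8), lt_min (by linarith) (by norm_num), fun δ hδ hδle => ?_⟩
  have hδr : 2 * δ ≤ r := by linarith [min_le_left (r / 2) (1 / 8)]
  have hδ8 : δ ≤ 1 / 8 := hδle.trans (min_le_right _ _)
  have hδrN : 2 * δ ≤ rN N := hδr.trans hrN
  have hδ1 : δ ≤ 1 := by linarith
  have hδ2 : δ ≤ 1 / 2 := by linarith
  -- the box `S`, its image `A = Φ(S)`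
  set S := Sbox N δ with hS
  set A := Phi '' S with hA
  have hSsub : S ⊆ closedBall 0 r := fun a ha => by
    rw [mem_closedBall, dist_zero_right]; exact (norm_le_of_mem_Sbox hδ.le ha).trans hδr
  have happS : ApproximatesLinearOn Phi (ContinuousLinearMap.id ℝ (𝔼 (N + 1))) S c := happ.mono_set hSsub
  have hvolA_le : volume A ≤ mhi * volume S := hcup S Phi happS
  have hvolA_ge : (mlo : ℝ≥0∞) * volume S ≤ volume A := hclow S Phi happS
  -- `A ⊆ B̄(0, 4δ)`
  have hAsub : A ⊆ closedBall 0 (4 * δ) := by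
    rintro x ⟨a, ha, rfl⟩
    have h0 : (0 : 𝔼 (N + 1)) ∈ closedBall (0 : 𝔼 (N + 1)) r := by simp [hr0.le]
    have h := happ a (hSsub ha) 0 h0
    simp only [Phi_zero, sub_zero, ContinuousLinearMap.id_apply] at h
    have hc1' : (c : ℝ) ≤ 1 := by exact_mod_cast hc1.le
    rw [mem_closedBall, dist_zero_right]
    have ha2 := norm_le_of_mem_Sbox hδ.le ha
    calc ‖Phi a‖ = ‖(Phi a - a) + a‖ := by rw [sub_add_cancel]
      _ ≤ ‖Phi a - a‖ + ‖a‖ := norm_add_le _ _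
      _ ≤ c * ‖a‖ + ‖a‖ := add_le_add h le_rfl
      _ ≤ 4 * δ := by nlinarith [norm_nonneg a]
  -- Haar side
  have hνA : chartMeasure (N + 1) A =
      ENNReal.ofReal (δ / π) * ENNReal.ofReal (δ ^ (2 * N)) * chartMeasure N (closedBall 0 δ) :=
    chartMeasure_image_Phi_Sbox hδ hδ1 hδrN
  have hνA_le : chartMeasure (N + 1) A ≤ haarChartConst (N + 1) * volume A := chartMeasure_le A
  have hνA_ge : lowerConst (N + 1) (4 * δ) * volume A ≤ chartMeasure (N + 1) A :=
    le_chartMeasure_of_subset (by linarith) (by linarith) hAsub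
  have hνN_le : chartMeasure N (closedBall 0 δ) ≤ haarChartConst N * volume (closedBall (0 : 𝔼 N) δ) :=
    chartMeasure_le _
  have hνN_ge : lowerConst N δ * volume (closedBall (0 : 𝔼 N) δ) ≤ chartMeasure N (closedBall 0 δ) :=
    le_chartMeasure_of_subset hδ hδ2 subset_rfl
  -- the common factor `P = vol(B̄_{N²}(δ)) δ δ^{2N}`
  set P := volume (closedBall (0 : 𝔼 N) δ) * (ENNReal.ofReal δ * ENNReal.ofReal (δ ^ (2 * N))) with hP
  obtain ⟨hV0, hVt⟩ := volume_closedBall_ne (n := N) hδ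
  have hP0 : P ≠ 0 := mul_ne_zero hV0 (mul_ne_zero (by simp [hδ]) (by simp [pow_pos hδ]))
  have hPt : P ≠ ∞ := ENNReal.mul_ne_top hVt (ENNReal.mul_ne_top ENNReal.ofReal_ne_top ENNReal.ofReal_ne_top)
  have hvolS : volume S = P * ENNReal.ofReal (QN N) := by
    rw [hS, volume_Sbox hδ, hP, QN, ENNReal.ofReal_mul (by norm_num : (0:ℝ) ≤ 2),
      show (2 : ℝ) ^ (N + 1) * π ^ N / N.factorial = 2 * (2 ^ N * π ^ N / N.factorial) by ring,
      ENNReal.ofReal_mul (by norm_num : (0:ℝ) ≤ 2)]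
    ring
  have hπ : ENNReal.ofReal (δ / π) = ENNReal.ofReal δ * ENNReal.ofReal (1 / π) := by
    rw [← ENNReal.ofReal_mul hδ.le]; congr 1; ring
  have hνA_le' : chartMeasure (N + 1) A ≤ P * (haarChartConst N * ENNReal.ofReal (1 / π)) := by
    rw [hνA, hπ, hP]
    calc ENNReal.ofReal δ * ENNReal.ofReal (1 / π) * ENNReal.ofReal (δ ^ (2 * N)) * chartMeasure N (closedBall 0 δ)
        ≤ ENNReal.ofReal δ * ENNReal.ofReal (1 / π) * ENNReal.ofReal (δ ^ (2 * N)) *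
          (haarChartConst N * volume (closedBall (0 : 𝔼 N) δ)) := by gcongr
      _ = _ := by ring
  have hνA_ge' : P * (lowerConst N δ * ENNReal.ofReal (1 / π)) ≤ chartMeasure (N + 1) A := by
    rw [hνA, hπ, hP]
    calc volume (closedBall (0 : 𝔼 N) δ) * (ENNReal.ofReal δ * ENNReal.ofReal (δ ^ (2 * N))) *
          (lowerConst N δ * ENNReal.ofReal (1 / π))
        = ENNReal.ofReal δ * ENNReal.ofReal (1 / π) * ENNReal.ofReal (δ ^ (2 * N)) *
          (lowerConst N δ * volume (closedBall (0 : 𝔼 N) δ)) := by ring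
      _ ≤ _ := by gcongr
  constructor
  · -- `P · (lowerConst_N(δ)/π) ≤ ν(A) ≤ c_{N+1} vol A ≤ c_{N+1} m₊ vol S = P · (c_{N+1} m₊ Q)`
    have h : P * (lowerConst N δ * ENNReal.ofReal (1 / π)) ≤
        P * ((haarChartConst (N + 1) : ℝ≥0∞) * mhi * ENNReal.ofReal (QN N)) := by
      calc P * (lowerConst N δ * ENNReal.ofReal (1 / π)) ≤ chartMeasure (N + 1) A := hνA_ge'
        _ ≤ haarChartConst (N + 1) * volume A := hνA_le
        _ ≤ haarChartConst (N + 1) * (mhi * volume S) := by gcongr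
        _ = P * ((haarChartConst (N + 1) : ℝ≥0∞) * mhi * ENNReal.ofReal (QN N)) := by rw [hvolS]; ring
    exact (ENNReal.mul_le_mul_iff_right hP0 hPt).1 h
  · have h : P * (lowerConst (N + 1) (4 * δ) * mlo * ENNReal.ofReal (QN N)) ≤
        P * ((haarChartConst N : ℝ≥0∞) * ENNReal.ofReal (1 / π)) := by
      calc P * (lowerConst (N + 1) (4 * δ) * mlo * ENNReal.ofReal (QN N))
          = lowerConst (N + 1) (4 * δ) * (mlo * volume S) := by rw [hvolS]; ring
        _ ≤ lowerConst (N + 1) (4 * δ) * volume A := by gcongr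
        _ ≤ chartMeasure (N + 1) A := hνA_ge
        _ ≤ P * ((haarChartConst N : ℝ≥0∞) * ENNReal.ofReal (1 / π)) := hνA_le'
    exact (ENNReal.mul_le_mul_iff_right hP0 hPt).1 h

/-- **The induction step in `ℝ≥0∞` form**: `c_{N+1} Q_N = c_N/π`. [folklore] -/
theorem haarChartConst_succ_mul_QN :
    (haarChartConst (N + 1) : ℝ≥0∞) * ENNReal.ofReal (QN N) = (haarChartConst N : ℝ≥0∞) * ENNReal.ofReal (1 / π) := by
  -- limits in `δ`
  have hF1 : ∀ mhi : ℝ≥0, 1 < mhi →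
      (haarChartConst N : ℝ≥0∞) * ENNReal.ofReal (1 / π) ≤ (haarChartConst (N + 1) : ℝ≥0∞) * mhi * ENNReal.ofReal (QN N) := by
    intro mhi hhi
    obtain ⟨δ₀, hδ₀, h⟩ := sandwich (N := N) (mlo := 1 / 2) (by norm_num) hhi
    have hT := ENNReal.Tendsto.mul_const (tendsto_lowerConst N 1) (b := ENNReal.ofReal (1 / π))
      (Or.inr ENNReal.ofReal_ne_top)
    simp only [one_mul] at hT
    refine le_of_tendsto hT ?_
    filter_upwards [Ioc_mem_nhdsGT hδ₀] with δ hδ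
    exact (h δ hδ.1 hδ.2).1
  have hF2 : ∀ mlo : ℝ≥0, mlo < 1 →
      (haarChartConst (N + 1) : ℝ≥0∞) * mlo * ENNReal.ofReal (QN N) ≤ (haarChartConst N : ℝ≥0∞) * ENNReal.ofReal (1 / π) := by
    intro mlo hlo
    obtain ⟨δ₀, hδ₀, h⟩ := sandwich (N := N) (mhi := 2) hlo (by norm_num)
    have hT := ENNReal.Tendsto.mul_const (tendsto_lowerConst (N + 1) 4)
      (b := (mlo : ℝ≥0∞) * ENNReal.ofReal (QN N)) (Or.inr (ENNReal.mul_ne_top ENNReal.coe_ne_top ENNReal.ofReal_ne_top))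
    have hT' : Tendsto (fun δ : ℝ => lowerConst (N + 1) (4 * δ) * mlo * ENNReal.ofReal (QN N)) (𝓝[>] 0)
        (𝓝 ((haarChartConst (N + 1) : ℝ≥0∞) * mlo * ENNReal.ofReal (QN N))) := by
      simpa only [mul_assoc] using hT
    refine le_of_tendsto hT' ?_
    filter_upwards [Ioc_mem_nhdsGT hδ₀] with δ hδ
    exact (h δ hδ.1 hδ.2).2
  -- pass to real numbers
  set x : ℝ := (haarChartConst (N + 1) : ℝ) * QN N with hx
  set y : ℝ := (haarChartConst N : ℝ) * (1 / π) with hy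
  have hQ := QN_pos N
  have hx0 : 0 ≤ x := by rw [hx]; exact mul_nonneg (NNReal.coe_nonneg _) hQ.le
  have hxe : (haarChartConst (N + 1) : ℝ≥0∞) * ENNReal.ofReal (QN N) = ENNReal.ofReal x := by
    rw [hx, ENNReal.ofReal_mul (by positivity), ENNReal.ofReal_coe_nnreal]
  have hye : (haarChartConst N : ℝ≥0∞) * ENNReal.ofReal (1 / π) = ENNReal.ofReal y := by
    rw [hy, ENNReal.ofReal_mul (by positivity), ENNReal.ofReal_coe_nnreal]
  have h1 : ∀ ε : ℝ, 0 < ε → y ≤ (1 + ε) * x := by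
    intro ε hε
    set m : ℝ≥0 := (1 + ε).toNNReal with hm
    have hm1 : 1 < m := by rw [hm, Real.lt_toNNReal_iff_coe_lt, NNReal.coe_one]; linarith
    have hmc : (m : ℝ≥0∞) = ENNReal.ofReal (1 + ε) := rfl
    have h := hF1 m hm1
    have h' : ENNReal.ofReal y ≤ ENNReal.ofReal ((1 + ε) * x) := by
      calc ENNReal.ofReal y = (haarChartConst N : ℝ≥0∞) * ENNReal.ofReal (1 / π) := hye.symm
        _ ≤ (haarChartConst (N + 1) : ℝ≥0∞) * m * ENNReal.ofReal (QN N) := h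
        _ = (m : ℝ≥0∞) * ((haarChartConst (N + 1) : ℝ≥0∞) * ENNReal.ofReal (QN N)) := by ring
        _ = ENNReal.ofReal ((1 + ε) * x) := by rw [hxe, hmc, ← ENNReal.ofReal_mul (by linarith)]
    exact (ENNReal.ofReal_le_ofReal_iff (by positivity)).1 h'
  have h2 : ∀ ε : ℝ, 0 < ε → ε < 1 → (1 - ε) * x ≤ y := by
    intro ε hε hε1
    set m : ℝ≥0 := (1 - ε).toNNReal with hm
    have hm1 : m < 1 := by rw [hm, Real.toNNReal_lt_iff_lt_coe (by linarith), NNReal.coe_one]; linarith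
    have hmc : (m : ℝ≥0∞) = ENNReal.ofReal (1 - ε) := rfl
    have hy0 : 0 ≤ y := by rw [hy]; positivity
    have h := hF2 m hm1
    have h' : ENNReal.ofReal ((1 - ε) * x) ≤ ENNReal.ofReal y := by
      calc ENNReal.ofReal ((1 - ε) * x) = (m : ℝ≥0∞) * ((haarChartConst (N + 1) : ℝ≥0∞) * ENNReal.ofReal (QN N)) := by
            rw [hxe, hmc, ← ENNReal.ofReal_mul (by linarith)]
        _ = (haarChartConst (N + 1) : ℝ≥0∞) * m * ENNReal.ofReal (QN N) := by ring
        _ ≤ (haarChartConst N : ℝ≥0∞) * ENNReal.ofReal (1 / π) := h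
        _ = ENNReal.ofReal y := hye
    exact (ENNReal.ofReal_le_ofReal_iff hy0).1 h'
  have hxy : x = y := by
    apply le_antisymm
    · -- from `(1 - ε) x ≤ y`
      have hT : Tendsto (fun ε : ℝ => (1 - ε) * x) (𝓝[>] 0) (𝓝 ((1 - 0) * x)) :=
        (((continuous_const.sub continuous_id).mul continuous_const).tendsto 0).mono_left nhdsWithin_le_nhds
      rw [sub_zero, one_mul] at hT
      refine le_of_tendsto hT ?_
      filter_upwards [Ioo_mem_nhdsGT zero_lt_one] with ε hε using h2 ε hε.1 hε.2
    · have hT : Tendsto (fun ε : ℝ => (1 + ε) * x) (𝓝[>] 0) (𝓝 ((1 + 0) * x)) :=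
        (((continuous_const.add continuous_id).mul continuous_const).tendsto 0).mono_left nhdsWithin_le_nhds
      rw [add_zero, one_mul] at hT
      refine ge_of_tendsto hT ?_
      filter_upwards [self_mem_nhdsWithin] with ε hε using h1 ε hε
  rw [hxe, hye, hxy]

/-- **The induction step**: `c_{N+1} = c_N · N! / (2π)^{N+1}`. [folklore] -/
theorem haarChartConst_succ (N : ℕ) :
    (haarChartConst (N + 1) : ℝ) = haarChartConst N * (N.factorial / (2 * π) ^ (N + 1)) := by
  have h := haarChartConst_succ_mul_QN (N := N)
  rw [← ENNReal.ofReal_coe_nnreal, ← ENNReal.ofReal_coe_nnreal, ← ENNReal.ofReal_mul (by positivity),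
    ← ENNReal.ofReal_mul (by positivity), ENNReal.ofReal_eq_ofReal_iff (by positivity [QN_pos N]) (by positivity)] at h
  have hQ := (QN_pos N).ne'
  have h' : (haarChartConst (N + 1) : ℝ) = haarChartConst N * (1 / π) / QN N := by
    rw [← h, mul_div_assoc, div_self hQ, mul_one]
  have hπ : (π : ℝ) ≠ 0 := Real.pi_pos.ne'
  have hf : (N.factorial : ℝ) ≠ 0 := by positivity
  rw [h', QN]
  field_simp
  ring

end Limit

/-! ### Base case and the closed form -/

section Main

open Metric

/-- **Base case**: `c_0 = 1` (`U(0)` is the trivial group and `ℝ^0` a point, so the ball ratio is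
identically `1`). [folklore] -/
theorem haarChartConst_zero : haarChartConst 0 = 1 := by
  have h1 : ∀ δ : ℝ, 0 < δ → ballRatio 0 δ = 1 := by
    intro δ hδ
    rw [ballRatio]
    have hG : gball 0 δ = univ := by
      ext U
      simp only [mem_gball, mem_univ, iff_true]
      have : ((U : 𝔾 0) : Matrix (Fin 0) (Fin 0) ℂ) - 1 = 0 := Subsingleton.elim _ _
      rw [this, norm_zero]; exact hδ.le
    have hE : volume (closedBall (0 : 𝔼 0) δ) = 1 := by
      haveI : IsEmpty (Fin 0 × Fin 0) := by infer_instance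
      rw [volume_euclideanSpace_eq_dirac]
      simp [hδ.le]
    rw [hG, measure_univ, hE, div_one]
  have hT : Tendsto (ballRatio 0) (𝓝[>] 0) (𝓝 1) := by
    apply tendsto_const_nhds.congr'
    filter_upwards [self_mem_nhdsWithin] with δ hδ using (h1 δ hδ).symm
  have huniq := tendsto_nhds_unique tendsto_ballRatio hT
  exact_mod_cast huniq

/-- **The Haar small-ball constant of `U(N)` in product form**:
`c_N = ∏_{j<N} j!/(2π)^{j+1}`. [cite: arXiv160201222, Thm. 6.1] -/
theorem haarChartConst_eq_prod (N : ℕ) :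
    (haarChartConst N : ℝ) = ∏ j ∈ Finset.range N, ((j.factorial : ℝ) / (2 * π) ^ (j + 1)) := by
  induction N with
  | zero => simp [haarChartConst_zero]
  | succ n ih => rw [haarChartConst_succ, ih, Finset.prod_range_succ]

/-- `Σ_{j<N} (j+1) = N(N+1)/2`. [folklore] -/
theorem sum_range_succ_eq (N : ℕ) : ∑ j ∈ Finset.range N, (j + 1) = N * (N + 1) / 2 := by
  have h : (∑ j ∈ Finset.range N, (j + 1)) * 2 = N * (N + 1) := by
    induction N with
    | zero => simp
    | succ n ih => rw [Finset.sum_range_succ, add_mul, ih]; ring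
  omega

/-- `N(N+1)/2` is an honest integer: `((N(N+1)/2 : ℕ) : ℝ) = N(N+1)/2`. [folklore] -/
theorem cast_triangle (N : ℕ) : ((N * (N + 1) / 2 : ℕ) : ℝ) = (N : ℝ) * (N + 1) / 2 := by
  have h3 : (N * (N + 1) / 2) * 2 = N * (N + 1) := Nat.div_mul_cancel (by
    rcases Nat.even_or_odd N with ⟨k, hk⟩ | ⟨k, hk⟩ <;> subst hk <;> ring_nf <;> omega)
  have h2 : ((N * (N + 1) / 2 : ℕ) : ℝ) * 2 = N * (N + 1) := by exact_mod_cast h3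
  linarith

/-- **Chatterjee's Theorem 6.1 / Theorem 11.1 constant** (S. Chatterjee, *The leading term of the
Yang–Mills free energy*, JFA 271 (2016), arXiv:1602.01222): the density at the identity of the Haar
probability measure of `U(N)` with respect to Lebesgue measure in a chart of `ℝ^{N²}` tangent to
Hilbert–Schmidt-isometric coordinates (here the Cayley chart of `UnitaryCayleyChart`;
`haarChartConst N = lim_{δ→0} σ(B_HS(1,δ))/vol(b_{ℝ^{N²}}(0,δ))`) is

  `c_N = ∏_{j=1}^{N-1} j! / (2π)^{N(N+1)/2}`,

i.e. `vol_HS(U(N)) = (2π)^{N(N+1)/2} / ∏_{j<N} j!`. Printed proof: Weyl's integration formula and a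
Selberg integral; here: induction on `N` along the fibration `U(N) → U(N+1) → S^{2N+1}`.
[cite: arXiv160201222, Thm. 6.1] -/
theorem haarChartConst_eq (N : ℕ) :
    (haarChartConst N : ℝ) = (∏ j ∈ Finset.range N, (j.factorial : ℝ)) / (2 * π) ^ (N * (N + 1) / 2) := by
  rw [haarChartConst_eq_prod, Finset.prod_div_distrib, Finset.prod_pow_eq_pow_sum, sum_range_succ_eq]

/-- The constant in the form it enters Chatterjee's Theorem 2.1:
`log c_N + (N²/2) log(2π) = log(∏_{j<N} j! / (2π)^{N/2})` (the Gaussian normalisation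
`(2π)^{N²/2}` per free edge combines with `c_N`). [cite: arXiv160201222, Thm. 11.1] -/
theorem log_haarChartConst_add (N : ℕ) :
    Real.log (haarChartConst N) + (N : ℝ) ^ 2 / 2 * Real.log (2 * π) =
      Real.log ((∏ j ∈ Finset.range N, (j.factorial : ℝ)) / (2 * π) ^ ((N : ℝ) / 2)) := by
  have h2π : (0 : ℝ) < 2 * π := by positivity
  have hP : (0 : ℝ) < ∏ j ∈ Finset.range N, (j.factorial : ℝ) := Finset.prod_pos fun j _ => by positivity
  rw [haarChartConst_eq, Real.log_div hP.ne' (pow_pos h2π _).ne', Real.log_div hP.ne' (Real.rpow_pos_of_pos h2π _).ne',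
    ← Real.rpow_natCast, Real.log_rpow h2π, Real.log_rpow h2π, cast_triangle]
  ring

/-- The same in multiplicative form: `c_N (2π)^{N²/2} = ∏_{j<N} j!/(2π)^{N/2}`. [cite: arXiv160201222, Thm. 11.1] -/
theorem haarChartConst_mul_rpow (N : ℕ) :
    (haarChartConst N : ℝ) * (2 * π) ^ ((N : ℝ) ^ 2 / 2) =
      (∏ j ∈ Finset.range N, (j.factorial : ℝ)) / (2 * π) ^ ((N : ℝ) / 2) := by
  have h2π : (0 : ℝ) < 2 * π := by positivity
  rw [haarChartConst_eq, ← Real.rpow_natCast, cast_triangle, div_mul_eq_mul_div, div_eq_div_iff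
    (Real.rpow_pos_of_pos h2π _).ne' (Real.rpow_pos_of_pos h2π _).ne', mul_assoc, ← Real.rpow_add h2π]
  congr 2
  ring

/-- **Chatterjee's Theorem 6.1 as printed**: `lim_{δ→0} σ{U ∈ U(N) : ‖I - U‖_HS ≤ δ}/δ^{N²}
= ∏_{j=1}^{N-1} j! / ((2π)^{N/2} 2^{N²/2} Γ(N²/2 + 1))` (the normalised Haar measure of small
Hilbert–Schmidt balls). [cite: arXiv160201222, Thm. 6.1] -/
theorem tendsto_haar_gball_div (N : ℕ) :
    Tendsto (fun δ : ℝ => (haarProbability (𝔾 N) (gball N δ)).toReal / δ ^ (N * N)) (𝓝[>] 0)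
      (𝓝 ((∏ j ∈ Finset.range N, (j.factorial : ℝ)) /
        ((2 * π) ^ ((N : ℝ) / 2) * 2 ^ ((N : ℝ) ^ 2 / 2) * Real.Gamma ((N : ℝ) ^ 2 / 2 + 1)))) := by
  -- `σ(gball δ)/δ^{N²} = ballRatio(δ) · vol(b(0,1))`
  set V1 : ℝ := (volume (closedBall (0 : 𝔼 N) 1)).toReal with hV1
  have hV1eq : V1 = Real.sqrt π ^ (N * N) / Real.Gamma ((N * N : ℕ) / 2 + 1) := by
    rw [hV1]
    rcases Nat.eq_zero_or_pos N with hN | hN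
    · subst hN
      haveI : IsEmpty (Fin 0 × Fin 0) := by infer_instance
      rw [volume_euclideanSpace_eq_dirac]
      simp
    · haveI : Nonempty (Fin N × Fin N) := ⟨(⟨0, hN⟩, ⟨0, hN⟩)⟩
      rw [EuclideanSpace.volume_closedBall, Fintype.card_prod, Fintype.card_fin, ENNReal.ofReal_one, one_pow, one_mul,
        ENNReal.toReal_ofReal (by positivity)]
  have hfun : ∀ δ : ℝ, 0 < δ → (haarProbability (𝔾 N) (gball N δ)).toReal / δ ^ (N * N) = (ballRatio N δ).toReal * V1 := by
    intro δ hδ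
    rw [ballRatio, ENNReal.toReal_div, volume_closedBall_𝔼 0 hδ.le, ENNReal.toReal_mul,
      ENNReal.toReal_ofReal (by positivity), ← hV1]
    have hV1pos : 0 < V1 := by
      rw [hV1]; exact ENNReal.toReal_pos (volume_closedBall_𝔼_pos 0 one_pos).ne' (volume_closedBall_𝔼_lt_top 0 1).ne
    field_simp
  have hT : Tendsto (fun δ : ℝ => (ballRatio N δ).toReal * V1) (𝓝[>] 0) (𝓝 ((haarChartConst N : ℝ≥0∞).toReal * V1)) :=
    ((ENNReal.tendsto_toReal ENNReal.coe_ne_top).comp tendsto_ballRatio).mul_const V1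
  have hlim : (haarChartConst N : ℝ≥0∞).toReal * V1 =
      (∏ j ∈ Finset.range N, (j.factorial : ℝ)) /
        ((2 * π) ^ ((N : ℝ) / 2) * 2 ^ ((N : ℝ) ^ 2 / 2) * Real.Gamma ((N : ℝ) ^ 2 / 2 + 1)) := by
    rw [ENNReal.coe_toReal, haarChartConst_eq, hV1eq]
    have hπ : 0 < π := Real.pi_pos
    have h2π : (0 : ℝ) < 2 * π := by positivity
    -- `(2π)^{N(N+1)/2} = (2π)^{N/2} (2π)^{N²/2}` and `√π^{N²} = π^{N²/2}` as real powers
    have e1 : ((2 * π) ^ (N * (N + 1) / 2) : ℝ) = (2 * π) ^ ((N : ℝ) / 2) * (2 * π) ^ ((N : ℝ) ^ 2 / 2) := by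
      rw [← Real.rpow_natCast, ← Real.rpow_add h2π]
      congr 1
      rw [cast_triangle]; ring
    have e2 : (Real.sqrt π ^ (N * N) : ℝ) = π ^ ((N : ℝ) ^ 2 / 2) := by
      rw [Real.sqrt_eq_rpow, ← Real.rpow_natCast, ← Real.rpow_mul hπ.le]
      congr 1; push_cast; ring
    have e3 : ((2 * π) ^ ((N : ℝ) ^ 2 / 2) : ℝ) = 2 ^ ((N : ℝ) ^ 2 / 2) * π ^ ((N : ℝ) ^ 2 / 2) :=
      Real.mul_rpow (by norm_num) hπ.le
    have e4 : ((N * N : ℕ) : ℝ) / 2 + 1 = (N : ℝ) ^ 2 / 2 + 1 := by push_cast; ring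
    rw [e1, e2, e3, e4]
    have hp1 : 0 < (2 * π) ^ ((N : ℝ) / 2) := Real.rpow_pos_of_pos h2π _
    have hp2 : 0 < (2 : ℝ) ^ ((N : ℝ) ^ 2 / 2) := Real.rpow_pos_of_pos (by norm_num) _
    have hp3 : 0 < π ^ ((N : ℝ) ^ 2 / 2) := Real.rpow_pos_of_pos hπ _
    have hp4 : 0 < Real.Gamma ((N : ℝ) ^ 2 / 2 + 1) := Real.Gamma_pos_of_pos (by positivity)
    field_simp
  rw [← hlim]
  refine hT.congr' ?_
  filter_upwards [self_mem_nhdsWithin] with δ hδ using (hfun δ hδ).symm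

end Main

end UnitaryColumn

end Literature.MathematicalPhysics.QuantumFieldTheory
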